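import Summits.BirchSwinnertonDyer.BirchSwinnertonDyer.Theorems.TwoAdicConverseOrdLambdaHalfAtTwoXiDominantKlingenDefs
import Summits.BirchSwinnertonDyer.BirchSwinnertonDyer.Theorems.TwoAdicConverseOrdLambdaHalfAtTwoXiGeneratorPairs
import Summits.BirchSwinnertonDyer.BirchSwinnertonDyer.Theorems.TwoAdicConverseOrdLambdaHalfAtTwoXiIrrK
import Summits.BirchSwinnertonDyer.BirchSwinnertonDyer.Theorems.TwoAdicConverseOrdLambdaHalfAtTwoXiField
import Summits.BirchSwinnertonDyer.BirchSwinnertonDyer.Theorems.TwoAdicConverseOrdLambdaHalfAtTwoGreenbergTwistOrdinary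
import HarnessLib

/-!
# Route `TwoAdicConverse` (rung S3), crux `OrdLambdaHalfAtTwo` (item stmt-BirchSwinnertonDyer-19556), line
# `xi_dominant_klingen_two` (habitat S₃): the SUPPLY stub `stub_supplyAtTwo` — the `ξ`-datum exists

Cell `bsd-2adic`, seat `bsd-2adic-conv-1` GEN 27 (`--supports` stmt-BirchSwinnertonDyer-19556, helper; pen RC-311 (3) standing
pre-approval, RC-313: the xi line is checked + published but unregistered, so no stub credit).  `nonempty_xiDatum` has EXACTLY
the binder shape of `stub_supplyAtTwo` of `Cruxes/OrdLambdaHalfAtTwo/Lines/xi_dominant_klingen_two.lean` (l. 226), with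
`XiDatum` read from the Theorems-side transcription `TwoAdicConverseOrdLambdaHalfAtTwoXiDominantKlingenDefs.lean`; an (α) lead
that imports that Defs file closes the stub by `exact TwoAdicXiSupply.nonempty_xiDatum`.

Ingredients (all tree theorems; this GEN's: `…XiComplement`, `…XiGeneratorPairs`, `…XiIrrK`, `…XiField`):
field choice with a NON-split prime of the conductor; generator pairs of `Gal(K̃_∞/K) ≅ ℤ₂²` at `p = 2` (the pair
phenomenon); (irr_K) at `2` from surjectivity + ramification of `K` at a good prime; embedding data; twist-ordinarity.

HONEST FRAMING.  Supply/bookkeeping for an unstaffed line whose load-bearing stub (W2, `ξ`-dominant Klingen–Eisenstein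
divisibility on `GU(3,1)` at `2`) is research-open; closes nothing; BSD is not proved by any of this.  PARTITION (D-0054):
none — RANK axis S3 × X5@2 stratum S₃.
-/

-- D-0017: single-problem summit, the namespace repeats the problem name by design.
set_option linter.dupNamespace false
set_option autoImplicit false

noncomputable section

open scoped MatrixGroups ModularForm
open CongruenceSubgroup WeierstrassCurve NumberField IsDedekindDomain Field
open Literature.NumberTheory.EllipticCurves Literature.NumberTheory.GaloisRepresentations

namespace Summit.BirchSwinnertonDyer.BirchSwinnertonDyer.Theorems.TwoAdicXiSupply

/-! ## The supply stub -/

open Rank1Residual in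
/-- **`stub_supplyAtTwo` of line `xi_dominant_klingen_two` (crux 19556), VERBATIM over the Theorems-side `XiDatum`: on the
surjective habitat the `ξ`-datum EXISTS.**  For a globally minimal non-CM `W/ℚ` good ordinary at `2` with `ρ̄_{E,2}`
surjective, and the crux's cyclotomic `(κ, γ)`: `Nonempty (XiDatum W κ γ)`.  Assembly of: the field `K = ℚ(√-q)`
(`exists_xiField`: `q ≡ 7 (8)` prime, `q > 2N_E`, `2` split, `(N_E, d_K) = 1`, a non-split `ℓ ∣ N_E`); the two primes above
`2` and the embedding datum `ι` inducing `v` (tree `SignedBaseChangeK1FrameData.exists_pair_of_ncard_primesOver_eq_two`,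
`exists_iota`), `ι₁ = ι⁻¹|_{ℤ̄} → ℂ₂`, `J : ℤ₂ → 𝒪_{ℂ₂}` (tree `exists_structureMap_padicInt`); the two generator pairs with
the crux's normalisation (`exists_generatorPairs`, the 2-adic pair phenomenon); (irr_K) at `2` (`irrK_framed_of_surj_of_discr`,
`K` ramified at the good prime `q`); twist-ordinarity (`TwoAdicGreenbergTwist.goodOrd_two_of_smul_eq_quadraticTwist`,
`d_K ≡ 1 (mod 4)`).  The habitat binder `¬ W.HasCM` is idle (kept for the verbatim signature).  Closes nothing by itself
(the xi line is unregistered; its load-bearing stub W2 is research); BSD is not proved by any of this.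
[cite: BurungaleSkinnerTianWan2024, §9.4 (spl), (irr_L)] [cite: Serre1972, §5.3] -/
theorem nonempty_xiDatum :
    ∀ (W : WeierstrassCurve ℚ) [W.IsElliptic] [W.IsGloballyMinimal],
      ¬ W.HasCM → GoodOrd W 2 → W.HasSurjectiveModNGaloisRep 2 →
    ∀ (κ : ZpExtension ℚ 2) (γ : absoluteGaloisGroup ℚ),
      κ.IsCyclotomic → κ.IsTopGenerator γ → IsCyclotomicVariable 2 γ →
    Nonempty (XiDatum W κ γ) := by
  intro W _ _ _hCM hGO hs κ γ hκ hγ hγ'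
  haveI : Fact (Nat.Prime 2) := ⟨Nat.prime_two⟩
  have h2N := not_two_dvd_conductorNorm_of_goodOrd W hGO
  obtain ⟨K, iF, iN, q, ℓ, hK, hq, hq8, hqN, hdisc, hsplit, hcop, hℓ, hℓ2, hℓN, hℓns⟩ := exists_xiField W h2N
  haveI : NeZero (NumberField.discr K).natAbs :=
    ⟨by rw [hdisc, Int.natAbs_neg, Int.natAbs_natCast]; exact hq.ne_zero⟩
  have hq2 : q ≠ 2 := by omega
  have hqN' : ¬ q ∣ W.conductorNorm ℤ := by
    intro h
    have hpos : 0 < W.conductorNorm ℤ := W.conductorNorm_pos_holds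
    have := Nat.le_of_dvd hpos h
    omega
  -- the two primes above `2`
  obtain ⟨v, vbar, hv, hvbar, hne⟩ :=
    SignedBaseChangeK1FrameData.exists_pair_of_ncard_primesOver_eq_two (K := K) Nat.prime_two (by simpa using hsplit)
  -- embedding data
  obtain ⟨ι, hι⟩ := SignedBaseChangeK1FrameData.exists_iota (p := 2) hK v hv
  obtain ⟨J, hJ⟩ := Literature.NumberTheory.EllipticCurves.exists_structureMap_padicInt (p := 2)
  let ι₁ : integralClosure ℚ ℂ →+* ℂ_[2] :=
    (algebraMap (PadicAlgCl 2) ℂ_[2]).comp (ι.symm.toRingHom.comp ((integralClosure ℚ ℂ).val : integralClosure ℚ ℂ →+* ℂ))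
  -- the two generator pairs
  obtain ⟨κ₁, κ₂, γ₁, γ₂, κ₁', κ₂', γ₁', γ₂', hpair, hpair', hcyc, hac, hgen, hvar, -, -, -⟩ :=
    exists_generatorPairs hK κ hκ γ hγ hγ'
  -- (irr_K) at `2`
  have habs : ∀ ρ : ModPGaloisRep K (ZMod 2) 2, (W.baseChange K).IsTorsionGaloisRep 2 ρ →
      FramedRep.IsAbsolutelyIrreducible ρ :=
    irrK_framed_of_surj_of_discr W 2 (by exact_mod_cast hs) K hK.1 hq hq2 hq2 hdisc hqN'
  -- twist ordinarity
  have htw : ∀ (A : WeierstrassCurve ℚ) [A.IsElliptic] [A.IsGloballyMinimal] (C : VariableChange ℚ),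
      C • A = W.quadraticTwist ((NumberField.discr K : ℤ) : ℚ) → IsOrdinaryAt A 2 := fun A _ _ C hA ↦
    TwoAdicGreenbergTwist.goodOrd_two_of_smul_eq_quadraticTwist W A hGO (d := NumberField.discr K)
      (by rw [hdisc]; omega) hA
  refine ⟨{
    K := K
    ι := ι
    ι₁ := ι₁
    ι₁_compat := fun _ ↦ rfl
    J := J
    J_compat := hJ
    v := v
    vbar := vbar
    κ₁ := κ₁
    κ₂ := κ₂
    γ₁ := γ₁
    γ₂ := γ₂
    pair := ⟨hpair⟩
    κ₁' := κ₁'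
    κ₂' := κ₂'
    γ₁' := γ₁'
    γ₂' := γ₂'
    pair' := ⟨hpair'⟩
    isImaginaryQuadratic := hK
    split := hsplit
    mem_v := hv
    mem_vbar := hvbar
    vbar_ne := hne
    compat := hι
    coprime := hcop
    absIrr := habs
    exists_nonsplit := ⟨ℓ, hℓ, hℓN, hℓns⟩
    cyclotomic := hcyc
    anticyclotomic := hac
    restrict_topGenerator := hgen
    restrict_cyclotomicVariable := hvar
    twist_ordinary := htw }⟩

end Summit.BirchSwinnertonDyer.BirchSwinnertonDyer.Theorems.TwoAdicXiSupply

end
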